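import Literature.NumberTheory.GaloisCohomology.Howard2004.DualityDatumRestrictedPairingFlipProofs
import Literature.NumberTheory.GaloisRepresentations.ContinuousCupProductCompatMixed
import HarnessLib

/-!
# Naturality of the FLIPPED restricted local pairing `T/Fil_v × Fil′ → R(1)` along a tower: reduction compatibility
# (hB♭) and the two projection formulas (Adj♭), (Adj′♭) (theorems only; no definition, no named fact, no instance, no `sorry`)

Topic `NumberTheory/GaloisCohomology/Howard2004`.  The X/Y-flipped twin of x9-p1-w2's `DualityDatumRestrictedPairingNaturalityProofs`
((hB)/(Adj)/(Adj′) for the restricted pairing `P (s, [t]) = e (s, t)` of `DualityDatumRestrictedPairingProofs`), for the flipped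
restricted pairing `P♭ ([s], t) = e (s, t)` of `DualityDatumRestrictedPairingFlipProofs` (`DualityDatum.exists_restrictedPairing_flip`):
the level inputs of x10b-p1-w8's `Tower.pow_smul_eq_zero_of_forall_pairing_eq_zero` for the flipped pair of local towers
`H¹(K_v, W_j / Fil_v W_j) × H¹(K_v, Fil′_j) → H²(K_v, A_{m,j}(1))` in the second (Exact) clause of Howard's H.4 for `F_𝔮` at
`v ∣ p` (cell memo `HOME/p1/H4-EXACT-AT-P-PLAN-x10b-p1-g8.md` §1(c)–(f), (ANN-SAT-X)/(EXACT-X)).  For TWO levels (duality data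
`D₁`, `D₂` over `R₁`, `R₂`, flipped restricted pairings `P₁`, `P₂` characterised by `P_i ([s], t) = e_i (s, t)`, maps `u`/`r` of
the quotient and sub representations characterised by their underlying additive maps, and a value map `φ` intertwining the
Tate twists):

* `restrictedPairing_flip_cupProduct_map` (hB♭): `H²(φ)(x ∪₁ y) = H¹(u) x ∪₂ H¹(r) y` if `φ (e₁(s, t)) = e₂(U s, Rr t)`;
* `restrictedPairing_flip_cupProduct_map_adjoint` (Adj♭): `H²(φ)(H¹(u) w ∪₁ y) = w ∪₂ H¹(r) y` if `φ (e₁(U s, t)) = e₂(s, Rr t)`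
  (`u` contravariant on the quotient side, `r` covariant on the sub side);
* `restrictedPairing_flip_cupProduct_map_adjoint'` (Adj′♭): `H²(φ)(x ∪₁ H¹(r) w) = H¹(u) x ∪₂ w` if `φ (e₁(s, Rr t)) = e₂(U s, t)`.

All three are the generic `ContPairing.cupProduct_map[_adjoint[']]` once the module-level clause `hc` is read through
`P_i ([s], t) = e_i (s, t)` (quotient induction on the first argument).  Cell `pub/bsd-print-x9`, brick (B3♭).  Nothing
arithmetic is proved here; BSD is not proved by any of this.  Seat `bsd-line-x10b-p1-w7` g2.

References: [Howard2004HeegnerKolyvagin] §1.3 H.4 (arXiv:1202.6340 p. 7, L78–82), §1.6 (p. 11, L33–38), Lemma 3.1.1, Def. 3.2.5–3.2.6;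
[NeukirchSchmidtWingberg2008] I §4 (1.4.2)–(1.4.6); [MilneADT2006] I §0, Cor. 2.3.
-/

set_option autoImplicit false

noncomputable section

open Function NumberField IsDedekindDomain Field CategoryTheory
open scoped NumberField ContRepresentation

namespace Literature.NumberTheory.GaloisCohomology.Howard2004

open Literature.NumberTheory.GaloisRepresentations
open Literature.NumberTheory.GaloisRepresentations.DiscreteGaloisModule

variable {K : Type} [Field K] [NumberField K]
  {M₁ : Type} [AddCommGroup M₁] [TopologicalSpace M₁] [DiscreteTopology M₁]
  {M₂ : Type} [AddCommGroup M₂] [TopologicalSpace M₂] [DiscreteTopology M₂]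
  {R₁ : Type} [CommRing R₁] [Module R₁ M₁] [TopologicalSpace R₁] [DiscreteTopology R₁]
  {R₂ : Type} [CommRing R₂] [Module R₂ M₂] [TopologicalSpace R₂] [DiscreteTopology R₂]
  {p : ℕ} [Fact p.Prime] [Algebra ℤ_[p] R₁] [Algebra ℤ_[p] R₂] {cd : ConjugationDatum K}
  {ρ₁ : DiscreteGaloisModule K M₁} {ρ₂ : DiscreteGaloisModule K M₂}
  (D₁ : DualityDatum p cd ρ₁ R₁) (D₂ : DualityDatum p cd ρ₂ R₂) (v : HeightOneSpectrum (𝓞 K))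
  [CharZero (v.adicCompletion K)]
  {V₁ : Submodule ℤ M₁} {hV₁ : ∀ σ : absoluteGaloisGroup (v.adicCompletion K), V₁ ≤ V₁.comap (GaloisRep.toLocal v ρ₁ σ)}
  {V₁' : Submodule ℤ M₁}
  {hV₁' : ∀ σ : absoluteGaloisGroup (v.adicCompletion K), V₁' ≤ V₁'.comap (GaloisRep.toLocal v (cd.twist ρ₁) σ)}
  {V₂ : Submodule ℤ M₂} {hV₂ : ∀ σ : absoluteGaloisGroup (v.adicCompletion K), V₂ ≤ V₂.comap (GaloisRep.toLocal v ρ₂ σ)}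
  {V₂' : Submodule ℤ M₂}
  {hV₂' : ∀ σ : absoluteGaloisGroup (v.adicCompletion K), V₂' ≤ V₂'.comap (GaloisRep.toLocal v (cd.twist ρ₂) σ)}
  (P₁ : ContPairing ((GaloisRep.toLocal v ρ₁).quotient V₁ hV₁).toTopRep
    ((GaloisRep.toLocal v (cd.twist ρ₁)).subrepresentation V₁' hV₁').toTopRep (GaloisRep.toLocal v D₁.twistOne).toTopRep)
  (hP₁ : ∀ (s : M₁) (t : V₁'), P₁.toLin (Submodule.Quotient.mk s) t = D₁.e s (t : M₁))
  (P₂ : ContPairing ((GaloisRep.toLocal v ρ₂).quotient V₂ hV₂).toTopRep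
    ((GaloisRep.toLocal v (cd.twist ρ₂)).subrepresentation V₂' hV₂').toTopRep (GaloisRep.toLocal v D₂.twistOne).toTopRep)
  (hP₂ : ∀ (s : M₂) (t : V₂'), P₂.toLin (Submodule.Quotient.mk s) t = D₂.e s (t : M₂))
  (φ : R₁ →+ R₂) (hφ : ∀ (g : absoluteGaloisGroup K) (x : R₁), φ (D₁.twistOne g x) = D₂.twistOne g (φ x))

namespace DualityDatum

include hP₁ hP₂

/-- **(hB♭) for the flipped restricted pairings**: for `u : T₁/Fil₁ → T₂/Fil₂` over `U : T₁ → T₂`, `r : Fil′₁ → Fil′₂` over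
`Rr : T₁ → T₂` and `φ : R₁(1) → R₂(1)` with `φ (e₁(s, t)) = e₂(U s, Rr t)` (`SatisfiesH.e_red`):
`H²(φ)(x ∪₁ y) = H¹(u) x ∪₂ H¹(r) y`. [cite: Howard2004HeegnerKolyvagin, §1.6 (arXiv p. 11, L33–38) and H.4 (p. 7, L78–82)]
[cite: NeukirchSchmidtWingberg2008, I §4 (1.4.2)] -/
theorem restrictedPairing_flip_cupProduct_map
    (u : ((GaloisRep.toLocal v ρ₁).quotient V₁ hV₁).toContRepresentation →ⁱL
      ((GaloisRep.toLocal v ρ₂).quotient V₂ hV₂).toContRepresentation)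
    (U : M₁ →+ M₂) (hu : ∀ s : M₁, u (Submodule.Quotient.mk s) = Submodule.Quotient.mk (U s))
    (r : ((GaloisRep.toLocal v (cd.twist ρ₁)).subrepresentation V₁' hV₁').toContRepresentation →ⁱL
      ((GaloisRep.toLocal v (cd.twist ρ₂)).subrepresentation V₂' hV₂').toContRepresentation)
    (Rr : M₁ →+ M₂) (hr : ∀ t : V₁', ((r t : V₂') : M₂) = Rr t)
    (he : ∀ (s t : M₁), φ (D₁.e s t) = D₂.e (U s) (Rr t))
    (x : galoisCohomology ((GaloisRep.toLocal v ρ₁).quotient V₁ hV₁) 1)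
    (y : galoisCohomology ((GaloisRep.toLocal v (cd.twist ρ₁)).subrepresentation V₁' hV₁') 1) :
    ContinuousRep.cohomologyMap (GaloisRep.toLocal v D₁.twistOne) (GaloisRep.toLocal v D₂.twistOne) φ
        continuous_of_discreteTopology (fun _ z => hφ _ z) 2 (P₁.cupProduct x y) =
      P₂.cupProduct (galoisCohomology.map u 1 x) (galoisCohomology.map r 1 y) := by
  let γ : (GaloisRep.toLocal v D₁.twistOne).toTopRep ⟶ (GaloisRep.toLocal v D₂.twistOne).toTopRep :=
    TopRep.ofHom ⟨⟨φ.toIntLinearMap, continuous_of_discreteTopology⟩,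
      fun _ => ContinuousLinearMap.ext fun z => hφ _ z⟩
  have h := ContPairing.cupProduct_map P₁ P₂ (TopRep.ofHom u) (TopRep.ofHom r) γ (fun q t => by
    induction q using Submodule.Quotient.induction_on with
    | _ s =>
      change φ (P₁.toLin (Submodule.Quotient.mk s) t) = P₂.toLin (u (Submodule.Quotient.mk s)) (r t)
      rw [hP₁, hu, hP₂, hr, he]) x y
  exact h

/-- **(Adj♭) for the flipped restricted pairings** (the `hAdj` of `Tower.pow_smul_eq_zero_of_forall_pairing_eq_zero`:
reduction on the quotient side, division on the sub side): for `u : T₂/Fil₂ → T₁/Fil₁` over `U : T₂ → T₁` (an iterated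
reduction), `r : Fil′₁ → Fil′₂` over `Rr : T₁ → T₂` (a division) and `φ` with `φ (e₁(U s, t)) = e₂(s, Rr t)`:
`H²(φ)(H¹(u) w ∪₁ y) = w ∪₂ H¹(r) y`.
[cite: Howard2004HeegnerKolyvagin, §1.6 (arXiv p. 11, L33–38) and H.4 (p. 7, L78–82)] [cite: NeukirchSchmidtWingberg2008, I §4 (1.4.2)–(1.4.6)] -/
theorem restrictedPairing_flip_cupProduct_map_adjoint
    (u : ((GaloisRep.toLocal v ρ₂).quotient V₂ hV₂).toContRepresentation →ⁱL
      ((GaloisRep.toLocal v ρ₁).quotient V₁ hV₁).toContRepresentation)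
    (U : M₂ →+ M₁) (hu : ∀ s : M₂, u (Submodule.Quotient.mk s) = Submodule.Quotient.mk (U s))
    (r : ((GaloisRep.toLocal v (cd.twist ρ₁)).subrepresentation V₁' hV₁').toContRepresentation →ⁱL
      ((GaloisRep.toLocal v (cd.twist ρ₂)).subrepresentation V₂' hV₂').toContRepresentation)
    (Rr : M₁ →+ M₂) (hr : ∀ t : V₁', ((r t : V₂') : M₂) = Rr t)
    (he : ∀ (s : M₂) (t : M₁), φ (D₁.e (U s) t) = D₂.e s (Rr t))
    (w : galoisCohomology ((GaloisRep.toLocal v ρ₂).quotient V₂ hV₂) 1)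
    (y : galoisCohomology ((GaloisRep.toLocal v (cd.twist ρ₁)).subrepresentation V₁' hV₁') 1) :
    ContinuousRep.cohomologyMap (GaloisRep.toLocal v D₁.twistOne) (GaloisRep.toLocal v D₂.twistOne) φ
        continuous_of_discreteTopology (fun _ z => hφ _ z) 2 (P₁.cupProduct (galoisCohomology.map u 1 w) y) =
      P₂.cupProduct w (galoisCohomology.map r 1 y) := by
  let γ : (GaloisRep.toLocal v D₁.twistOne).toTopRep ⟶ (GaloisRep.toLocal v D₂.twistOne).toTopRep :=
    TopRep.ofHom ⟨⟨φ.toIntLinearMap, continuous_of_discreteTopology⟩,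
      fun _ => ContinuousLinearMap.ext fun z => hφ _ z⟩
  have h := ContPairing.cupProduct_map_adjoint P₁ P₂ (TopRep.ofHom u) (TopRep.ofHom r) γ (fun q t => by
    induction q using Submodule.Quotient.induction_on with
    | _ s =>
      change φ (P₁.toLin (u (Submodule.Quotient.mk s)) t) = P₂.toLin (Submodule.Quotient.mk s) (r t)
      rw [hu, hP₁, hP₂, hr, he]) w y
  exact h

/-- **(Adj′♭) for the flipped restricted pairings** (mirror variance: division on the quotient side, reduction on the sub
side): for `u : T₁/Fil₁ → T₂/Fil₂` over `U : T₁ → T₂`, `r : Fil′₂ → Fil′₁` over `Rr : T₂ → T₁` and `φ` with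
`φ (e₁(s, Rr t)) = e₂(U s, t)`: `H²(φ)(x ∪₁ H¹(r) w) = H¹(u) x ∪₂ w`.
[cite: Howard2004HeegnerKolyvagin, §1.6 (arXiv p. 11, L33–38) and H.4 (p. 7, L78–82)] [cite: NeukirchSchmidtWingberg2008, I §4 (1.4.2)–(1.4.6)] -/
theorem restrictedPairing_flip_cupProduct_map_adjoint'
    (u : ((GaloisRep.toLocal v ρ₁).quotient V₁ hV₁).toContRepresentation →ⁱL
      ((GaloisRep.toLocal v ρ₂).quotient V₂ hV₂).toContRepresentation)
    (U : M₁ →+ M₂) (hu : ∀ s : M₁, u (Submodule.Quotient.mk s) = Submodule.Quotient.mk (U s))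
    (r : ((GaloisRep.toLocal v (cd.twist ρ₂)).subrepresentation V₂' hV₂').toContRepresentation →ⁱL
      ((GaloisRep.toLocal v (cd.twist ρ₁)).subrepresentation V₁' hV₁').toContRepresentation)
    (Rr : M₂ →+ M₁) (hr : ∀ t : V₂', ((r t : V₁') : M₁) = Rr t)
    (he : ∀ (s : M₁) (t : M₂), φ (D₁.e s (Rr t)) = D₂.e (U s) t)
    (x : galoisCohomology ((GaloisRep.toLocal v ρ₁).quotient V₁ hV₁) 1)
    (w : galoisCohomology ((GaloisRep.toLocal v (cd.twist ρ₂)).subrepresentation V₂' hV₂') 1) :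
    ContinuousRep.cohomologyMap (GaloisRep.toLocal v D₁.twistOne) (GaloisRep.toLocal v D₂.twistOne) φ
        continuous_of_discreteTopology (fun _ z => hφ _ z) 2 (P₁.cupProduct x (galoisCohomology.map r 1 w)) =
      P₂.cupProduct (galoisCohomology.map u 1 x) w := by
  let γ : (GaloisRep.toLocal v D₁.twistOne).toTopRep ⟶ (GaloisRep.toLocal v D₂.twistOne).toTopRep :=
    TopRep.ofHom ⟨⟨φ.toIntLinearMap, continuous_of_discreteTopology⟩,
      fun _ => ContinuousLinearMap.ext fun z => hφ _ z⟩
  have h := ContPairing.cupProduct_map_adjoint' P₁ P₂ (TopRep.ofHom u) (TopRep.ofHom r) γ (fun q t => by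
    induction q using Submodule.Quotient.induction_on with
    | _ s =>
      change φ (P₁.toLin (Submodule.Quotient.mk s) (r t)) = P₂.toLin (u (Submodule.Quotient.mk s)) t
      rw [hP₁, hr, hu, hP₂, he]) x w
  exact h

end DualityDatum

end Literature.NumberTheory.GaloisCohomology.Howard2004

end
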